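import Summits.AtomisticToContinuum.FouriersLaw.Theses.EmbeddedDrudeMourre
import Summits.AtomisticToContinuum.FouriersLaw.Theses.KineticCorner
import Summits.AtomisticToContinuum.FouriersLaw.Theorems.EmbeddedDrudeMourreMourreDissolutionOfKineticCorner
import Summits.AtomisticToContinuum.FouriersLaw.Theorems.EmbeddedDrudeMourreDrudeDissolutionStubTargetGlue
import Summits.AtomisticToContinuum.FouriersLaw.Theorems.EmbeddedDrudeMourreDrudeDissolutionOfKineticCruxes
import Summits.AtomisticToContinuum.FouriersLaw.Theorems.KineticCornerStationaryCorrelationBound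
import Summits.AtomisticToContinuum.FouriersLaw.Theorems.EmbeddedDrudeMourreDrudeDissolutionOfBmKineticCruxes
import Summits.AtomisticToContinuum.FouriersLaw.Theorems.EmbeddedDrudeMourreDrudeDissolutionStubBmRigidity
import Literature.MathematicalPhysics.KineticTheory.InfiniteChainShiftInvariantUniqueness

/-!
# Line `Sketch` — LEAD'S SKELETON (rev 12) for crux `EmbeddedDrudeMourre.DrudeDissolution`
(stmt-AtomisticToContinuum-12593)

Lead `prover-line-stmt-AtomisticToContinuum-12593-c6-0`, 2026-08-16 (rev 1–3 lead -0, rev 4–5 lead -1, rev 6 lead c2,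
rev 7–10 lead c5). SAME composition idea as every earlier revision of this line — the crux follows from a TIME-DOMAIN
property of the summed current autocorrelation `C_T` of the canonical infinite-volume datum (integrable decay + positive
Green–Kubo integral, tiled into initial layer / kinetic windows / post-kinetic tail), turned into the Drude window by the
landed pure-analysis criteria S1 (`stub_integrableSpectralCriterion`) and S2 (Bochner).

Crux (FIXED; `Summit.AtomisticToContinuum.FouriersLaw.Theses.EmbeddedDrudeMourre.DrudeDissolution`):
`∀ ω₂ lam β γ > 0 ∃ T₀ > 0 ∀ T ∈ (0,T₀) ∃ μT D`, `μT` DLR at `T`, `D` `μT`-preserving with absolutely convergent summed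
current correlations, `∃ σ` finite with `C_T(t) = ∫ cos(ωt) dσ(ω)` for all `t`, and a window `(−δ, δ)` on which
`σ = g dω`, `g` continuous, `≥ 0`, `g 0 > 0`.

## What rev 11–12 change (and why)

rev 10 (lead c5) was complete modulo its two open stubs, route KineticCorner's cruxes `PostKineticTail` (stmt-3430) and
`KineticLimit` (stmt-3431) VERBATIM — research-open, and quantified over ALL "good triples" `(T, μ, D)`: every DLR state
and every `μ`-preserving `InfiniteChainDynamics` whatsoever, whose `unique` field is only relative to its own carrier
(route KineticCorner's own "KNOWN FORMAL GAP": exotic good dynamics are neither excluded nor analysable). A kinetic-limit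
proof can only ever be about the dynamics it constructs. rev 11 FACTORS THE RIGIDITY OUT, once and for all:

* U    `stub_bmRigidity` (NEW at rev 11; LANDED at rev 12, worker W1, p127446): in the Buttà–Marchioro class — `D.carrier = bmGood` and a DLR state
       at `T` invariant under the unit shift — the state is unique (`eq_of_isChainGibbsMeasure_of_isShiftInvariant_pinnedChain`),
       the flow is unique on `bmGood` (`InfiniteChainDynamics.unique`), `bmGood` is `μ`-full (`PreservesMeasure.1`), hence
       `C_T` is ONE function of `T` (the object MD measures and kinetic theory computes).
* PKT∃ `stub_bmPostKineticTail` (reshaped from PKT; research-open): for every `e > 0` there are `M, T₀ > 0` such that for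
       every `T ∈ (0,T₀)` SOME BM-class pair `(μ, D)` has `C_T ∈ L¹(MT⁻², ∞)` with `∫_{MT⁻²}^∞ |C_T| ≤ e`.
* KL∃  `stub_bmKineticLimit` (reshaped from KL; research-open): `∃ K ∈ L¹(0,∞)` with `∫₀^∞ K > 0` such that for all
       `0 < δ ≤ M`, `e > 0`, `T < T₀(δ,M,e)` SOME BM-class pair has `|∫_{δT⁻²}^{MT⁻²} C_T − ∫_δ^M K| ≤ e`.

These are the WEAKEST typings of the time-domain open core (existential, canonical dynamics; by U every typing over the BM
class is equivalent), and `PostKineticTail → PKT∃`, `KineticLimit → KL∃` (`bmPostKineticTail_of_postKineticTail`,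
`bmKineticLimit_of_kineticLimit`, landed p127311, witness = the canonical datum) keep rev 10's closure path: landing stmt-3430 ∧ stmt-3431
still closes the crux, as does landing stmt-12594 (`drudeDissolution_of_mourreDissolution`, p95944).

`DrudeDissolution_of` concludes the crux BY NAME: at `T < T₀` the canonical datum (`canonicalDatum`, p121356) is a good triple
in the BM class; by U the witnesses of PKT∃/KL∃ have its `C_T`; the landed a-priori bound `StationaryCorrelationBound`
(stmt-3435, `stationaryCorrelationBound_proof`, built on this line's CA/CVG/CVS-I/CVS-M p123008/p123205/p126269/p123604) and
the landed dominated tiling `targetGlue_tiling` (TG, p122724) give `C_T ∈ L¹(0,∞)`, `∫₀^∞ C_T ≥ c/2 > 0`; Bochner (S2) + S1.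

## Reshaping record
* rev 1–6: KineticShapeCriterion repaired → S1 + S2 + S3; S3 → S3a + S3b; S3a ⇐ H; S3b → S3b′ + S7; H closed at stmt-12594.
* rev 7–10 (lead c5): S3b′ ∧ S7 replaced by the KineticCorner decomposition; TG, CA, CVG, CVS-I, CVS-M, G landed; SCB
  (stmt-3435), TG (stmt-3436), G (stmt-3434) CLOSED; open = PKT, KL verbatim; deliverable p126782
  (`drudeDissolution_of_postKineticTail_of_kineticLimit`).
* rev 11 (this seat): PKT, KL (∀ good triples) → U + PKT∃ + KL∃ (rigidity factored; existential canonical-dynamics form).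
  Registered stubs: `stub_bmRigidity`, `stub_bmPostKineticTail`, `stub_bmKineticLimit`.
* rev 12 (this seat): U LANDED (p127446, `Theorems.DrudeDissolution.LineSketch.stub_bmRigidity`); the composition LANDED
  (p127311, `…LineSketch.drudeDissolution_of_bmRigidity_of_bmPostKineticTail_of_bmKineticLimit` +
  `…_of_postKineticTail_of_kineticLimit`, `Theorems/EmbeddedDrudeMourreDrudeDissolutionOfBmKineticCruxes.lean`) and is
  imported. Open stubs: PKT∃, KL∃ only (research-open).

## Disproof used (`Cruxes/DrudeDissolution/Disproof.lean`, cdisprove cycle 1 final, rc 0, 1 sorry = harmonic near-miss;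
re-read 2026-08-16T21:40Z: mtime 06:13Z, unchanged, no `-- Targets` section): §5 (window ⇏ `L¹`) — the line knowingly proves
more than the crux on the corner; §3d (low temperature = weak anharmonicity) — the kinetic time `T⁻²` and the `B·T²`
normalisation; §3c (junk inhabitants) — excluded here structurally: BM carrier + DLR clause + U.
-/

noncomputable section

open MeasureTheory Filter Set Function
open scoped Topology

namespace Summit.AtomisticToContinuum.FouriersLaw.Cruxes.DrudeDissolution

namespace LineSketch

open Literature.MathematicalPhysics.KineticTheory.HeatConduction

/-! ## Registered stubs (`sorry` only here; every signature self-contained over tree declarations) -/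

/-- **U `stub_bmRigidity` — RIGIDITY OF THE BUTTÀ–MARCHIORO CLASS** (provable now). For `pinnedChain ω₂ lam β γ`
(all `> 0`), `T > 0`, two DLR states `μ₁, μ₂` at `T` invariant under the unit shift and two infinite-volume dynamics
`D₁, D₂` with carrier EQUAL to BM's good set `bmGood`, `D₁` preserving `μ₁`: `μ₁ = μ₂` (uniqueness of the shift-invariant
DLR state, `eq_of_isChainGibbsMeasure_of_isShiftInvariant_pinnedChain`, with `IsShiftInvariant μ := h.map_eq`), the flows
agree on `bmGood` (`D₁.unique` applied to the `D₂`-orbit of `σ ∈ bmGood = D₂.carrier`, which stays in `bmGood = D₁.carrier`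
and solves the equations by `D₂.isSolution`, with `D₂.flow_zero`), and the summed current autocorrelations coincide at every
time (`currentCorrelation` is a `tsum` over `x` of integrals whose integrands agree `μ₁`-a.e., since `μ₁`-a.e. `σ ∈ D₁.carrier
= bmGood` by `PreservesMeasure.1`; `integral_congr_ae`, `tsum_congr`). [folklore] -/
theorem stub_bmRigidity :
    ∀ ω₂ lam β γ : ℝ, 0 < ω₂ → 0 < lam → 0 < β → 0 < γ →
      ∀ (T : ℝ) (μ₁ μ₂ : MeasureTheory.Measure Literature.MathematicalPhysics.KineticTheory.HeatConduction.ChainConfig)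
        (D₁ D₂ : Literature.MathematicalPhysics.KineticTheory.HeatConduction.InfiniteChainDynamics
          (Literature.MathematicalPhysics.KineticTheory.HeatConduction.pinnedChain ω₂ lam β γ)),
        0 < T →
        (Literature.MathematicalPhysics.KineticTheory.HeatConduction.pinnedChain ω₂ lam β γ).IsChainGibbsMeasure T μ₁ →
        (Literature.MathematicalPhysics.KineticTheory.HeatConduction.pinnedChain ω₂ lam β γ).IsChainGibbsMeasure T μ₂ →
        MeasureTheory.MeasurePreserving
          (fun σ : Literature.MathematicalPhysics.KineticTheory.HeatConduction.ChainConfig => fun i : ℤ => σ (i + 1)) μ₁ μ₁ →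
        MeasureTheory.MeasurePreserving
          (fun σ : Literature.MathematicalPhysics.KineticTheory.HeatConduction.ChainConfig => fun i : ℤ => σ (i + 1)) μ₂ μ₂ →
        D₁.carrier = (Literature.MathematicalPhysics.KineticTheory.HeatConduction.pinnedChain ω₂ lam β γ).bmGood →
        D₂.carrier = (Literature.MathematicalPhysics.KineticTheory.HeatConduction.pinnedChain ω₂ lam β γ).bmGood →
        D₁.PreservesMeasure μ₁ →
        μ₁ = μ₂ ∧
          (∀ (t : ℝ) (σ : Literature.MathematicalPhysics.KineticTheory.HeatConduction.ChainConfig),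
            σ ∈ (Literature.MathematicalPhysics.KineticTheory.HeatConduction.pinnedChain ω₂ lam β γ).bmGood →
              D₁.flow t σ = D₂.flow t σ) ∧
          ∀ t : ℝ, D₁.currentCorrelation μ₁ t = D₂.currentCorrelation μ₂ t :=
  -- LANDED (worker W1, p127446): `Theorems/EmbeddedDrudeMourreDrudeDissolutionStubBmRigidity.lean`
  Theorems.DrudeDissolution.LineSketch.stub_bmRigidity

/-- **PKT∃ `stub_bmPostKineticTail` — POST-KINETIC TAIL BOUND, EXISTENTIAL CANONICAL-DYNAMICS FORM** (reshaped from
stmt-AtomisticToContinuum-3430 `Theses.KineticCorner.PostKineticTail`, which implies it: `bmPostKineticTail_of_postKineticTail`).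
For `pinnedChain ω₂ lam β γ` (all `> 0`) and every `e > 0` there are `M, T₀ > 0` such that for every `T ∈ (0, T₀)` SOME pair
`(μ, D)` — `μ` a DLR state at `T` invariant under the unit shift, `D` an infinite-volume dynamics with carrier `bmGood`
preserving `μ` (by U its `C_T` is THE summed current autocorrelation of the chain at `T`) — has `C_T` integrable on
`(M·T⁻², ∞)` with `∫_{MT⁻²}^∞ |C_T| ≤ e`: decay of the current autocorrelation beyond ALL kinetic times at FIXED small `T`,
`T`-uniformly. OPEN PROBLEM (no kinetic-limit theorem reaches `t = ∞` at fixed coupling; the single non-perturbative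
input of the time-domain line; BLR2000 §7). Held by the lead. [cite: BonettoLebowitzReyBellet2000, §7 eq. (37)] -/
theorem stub_bmPostKineticTail :
    ∀ ω₂ lam β γ : ℝ, 0 < ω₂ → 0 < lam → 0 < β → 0 < γ → ∀ e : ℝ, 0 < e →
      ∃ M T₀ : ℝ, 0 < M ∧ 0 < T₀ ∧ ∀ T : ℝ, 0 < T → T < T₀ →
        ∃ (μ : MeasureTheory.Measure Literature.MathematicalPhysics.KineticTheory.HeatConduction.ChainConfig)
          (D : Literature.MathematicalPhysics.KineticTheory.HeatConduction.InfiniteChainDynamics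
            (Literature.MathematicalPhysics.KineticTheory.HeatConduction.pinnedChain ω₂ lam β γ)),
          (Literature.MathematicalPhysics.KineticTheory.HeatConduction.pinnedChain ω₂ lam β γ).IsChainGibbsMeasure T μ ∧
          MeasureTheory.MeasurePreserving
            (fun σ : Literature.MathematicalPhysics.KineticTheory.HeatConduction.ChainConfig => fun i : ℤ => σ (i + 1)) μ μ ∧
          D.carrier = (Literature.MathematicalPhysics.KineticTheory.HeatConduction.pinnedChain ω₂ lam β γ).bmGood ∧
          D.PreservesMeasure μ ∧
          MeasureTheory.IntegrableOn (D.currentCorrelation μ) (Set.Ioi (M / T ^ 2)) ∧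
          ∫ t in Set.Ioi (M / T ^ 2), |D.currentCorrelation μ t| ≤ e := by
  sorry

/-- **KL∃ `stub_bmKineticLimit` — WAVE-KINETIC LIMIT OF `C_T` ON EVERY KINETIC WINDOW WITH `∫₀^∞ K > 0`, EXISTENTIAL
CANONICAL-DYNAMICS FORM** (reshaped from stmt-AtomisticToContinuum-3431 `Theses.KineticCorner.KineticLimit`, which implies it:
`bmKineticLimit_of_kineticLimit`). For `pinnedChain ω₂ lam β γ` (all `> 0`): `∃ K ∈ L¹(0,∞)`, `∫₀^∞ K > 0`, such that for all
`0 < δ ≤ M`, `e > 0` there is `T₀ > 0` with: for every `T ∈ (0,T₀)` SOME BM-class pair `(μ, D)` (as in PKT∃) has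
`|∫_{δT⁻²}^{MT⁻²} C_T − ∫_δ^M K| ≤ e` (`K(τ) = ⟨v, e^{−τL}v⟩`, `L` the linearised phonon Boltzmann operator of the pinned
band, ALS06 §3; positivity = no odd collisional invariant (stmt-3432, CLOSED) + coercivity). OPEN PROBLEM (Lukkarinen–Spohn
programme; no equilibrium time-correlation kinetic limit for the thermal lattice `φ⁴` chain in print). Not briefed.
[cite: AokiLukkarinenSpohn2006, §3 (3.20)–(3.23)] -/
theorem stub_bmKineticLimit :
    ∀ ω₂ lam β γ : ℝ, 0 < ω₂ → 0 < lam → 0 < β → 0 < γ →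
      ∃ K : ℝ → ℝ, MeasureTheory.IntegrableOn K (Set.Ioi 0) ∧ 0 < ∫ τ in Set.Ioi 0, K τ ∧
        ∀ δ M e : ℝ, 0 < δ → δ ≤ M → 0 < e → ∃ T₀ : ℝ, 0 < T₀ ∧ ∀ T : ℝ, 0 < T → T < T₀ →
          ∃ (μ : MeasureTheory.Measure Literature.MathematicalPhysics.KineticTheory.HeatConduction.ChainConfig)
            (D : Literature.MathematicalPhysics.KineticTheory.HeatConduction.InfiniteChainDynamics
              (Literature.MathematicalPhysics.KineticTheory.HeatConduction.pinnedChain ω₂ lam β γ)),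
            (Literature.MathematicalPhysics.KineticTheory.HeatConduction.pinnedChain ω₂ lam β γ).IsChainGibbsMeasure T μ ∧
            MeasureTheory.MeasurePreserving
              (fun σ : Literature.MathematicalPhysics.KineticTheory.HeatConduction.ChainConfig => fun i : ℤ => σ (i + 1)) μ μ ∧
            D.carrier = (Literature.MathematicalPhysics.KineticTheory.HeatConduction.pinnedChain ω₂ lam β γ).bmGood ∧
            D.PreservesMeasure μ ∧
            |(∫ t in (δ / T ^ 2)..(M / T ^ 2), D.currentCorrelation μ t) - ∫ τ in δ..M, K τ| ≤ e := by
  sorry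

/-! ## rev 10's closure path is kept
Route KineticCorner's cruxes imply the existential forms — LANDED in the composition file (p127311):
`Theorems.DrudeDissolution.LineSketch.bmPostKineticTail_of_postKineticTail : KineticCorner.PostKineticTail → PKT∃`,
`Theorems.DrudeDissolution.LineSketch.bmKineticLimit_of_kineticLimit : KineticCorner.KineticLimit → KL∃`, and
`Theorems.DrudeDissolution.LineSketch.drudeDissolution_of_bmRigidity_of_postKineticTail_of_kineticLimit :
U → PostKineticTail → KineticLimit → DrudeDissolution` (witness = the canonical datum). -/

/-! ## Composition -/

/-- The line concludes the crux BY NAME from the registered stubs U (provable now, briefed), PKT∃, KL∃ (research-open):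
`c := ∫₀^∞ K > 0`; initial-layer width `δ` (`B⁺δ ≤ c/8`, `∫_{(0,δ]}|K| ≤ c/16`), tail datum `(M₀, T₀′)` of PKT∃ at `c/8`,
kinetic multiple `M ≥ max M₀ δ` with `∫_{(M,∞)}|K| ≤ c/16`, `T₀″` of KL∃ at `(δ, M, c/8)`; for `T < min T₀′ T₀″ T₁`: the
canonical datum `(Z.μ, D)` (`canonicalDatum`) is a good triple with carrier `bmGood`; by U the witnesses of PKT∃/KL∃ at `T`
have ITS `C_T`; `|C_T| ≤ B T²` (`stationaryCorrelationBound_proof`, stmt-3435) and the dominated tiling `targetGlue_tiling`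
(p122724) give `C_T ∈ L¹(0,∞)`, `|∫₀^∞ C_T − c| ≤ c/2`; `C_T` continuous, even, of positive type
(`regular_of_zeroWavenumberData`) ⇒ Bochner (`stub_cosineBochner`) + S1 (`stub_integrableSpectralCriterion`) ⇒ the window.
(The landed deliverable `drudeDissolution_of_bmRigidity_of_bmPostKineticTail_of_bmKineticLimit`, p127311,
`Theorems/EmbeddedDrudeMourreDrudeDissolutionOfBmKineticCruxes.lean`, applied to the three registered stubs.) -/
theorem DrudeDissolution_of : Theses.EmbeddedDrudeMourre.DrudeDissolution :=
  -- LANDED composition (p127311): `Theorems/EmbeddedDrudeMourreDrudeDissolutionOfBmKineticCruxes.lean`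
  Theorems.DrudeDissolution.LineSketch.drudeDissolution_of_bmRigidity_of_bmPostKineticTail_of_bmKineticLimit
    stub_bmRigidity stub_bmPostKineticTail stub_bmKineticLimit

end LineSketch

end Summit.AtomisticToContinuum.FouriersLaw.Cruxes.DrudeDissolution

end
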